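import Summits.BirchSwinnertonDyer.BirchSwinnertonDyer.Theses.PAdicOrderV2
import Summits.BirchSwinnertonDyer.BirchSwinnertonDyer.Theses.SelmerRank
import Summits.BirchSwinnertonDyer.BirchSwinnertonDyer.Theorems.PAdicOrderV2PAdicOrderComparisonR2ResidueTwoAligned

set_option linter.dupNamespace false

/-!
# Crux-strategist s2 census file for crux #2 `PAdicOrderComparisonR2` (stmt-BirchSwinnertonDyer-0489)

Scratch evidence for `STRATEGY-CENSUS.md` v2 (unit `cstrat-stmt-BirchSwinnertonDyer-0489-s2`).
Nothing here is route structure; it only TYPES census entry D5 over existing declarations.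

§ Decomposition D5 — the split BY PRIME along the route's own pre-declared repair line
(route header KILL CRITERIA (c) / NOT DECOMPOSED YET (v): "`5 ≤ p →` … a restatement for a
tenure pass"):

* `CompFiveLe` — the crux restricted to good ordinary `p ≥ 5` (the statement the thesis
  `PAdicOrderThesisR2` actually consumes through `CruxesToThesis`, whose proof picks `p ≥ 5`
  from `PAdicOrderExistsOrdinary`);
* `CompSmall`  — the residue at `p < 5`, i.e. `p ∈ {2, 3}`;
* glue `pAdicOrderComparisonR2_of_byPrime : CompFiveLe → CompSmall → PAdicOrderComparisonR2`
  PROVED (trivial seam), exactness `byPrime_of_pAdicOrderComparisonR2` PROVED (each child is a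
  literal weakening of the crux, so neither can be false while the crux is true);
* `compFiveLe_of_fiveRouteItems` — the `p ≥ 5` child is ITEMS-ONLY: it follows from five route
  items (SelmerRank LB / UB / SmallImage, `PAdicOrderSemisimpleR3`, `PAdicOrderMainConjectureR7`)
  by the landed `order_eq_analyticRank_five_le_of_fiveRouteItems` (p138680) — no stub, no
  Literature hypothesis. Hence every stub a line on the crux can still need lives in `CompSmall`
  (today: K2 `stub_katoAllPrimes`, NE2⁺ `stub_noExcessTwoPos`, both `p = 2`).

The census explains why this split is NOT filed with `route edit --split` (hygiene, not strategy;
route over cap; the instrument is the tenure restatement) and attaches these decls so that either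
instrument is one command.
-/

namespace Summit.BirchSwinnertonDyer.BirchSwinnertonDyer.Cruxes.PAdicOrderComparisonR2.Strategist2

open Summit.BirchSwinnertonDyer.BirchSwinnertonDyer.Theses.PAdicOrderV2
open Summit.BirchSwinnertonDyer.BirchSwinnertonDyer.Theses.SelmerRank (SelmerRankLB SelmerRankUB
  SelmerRankSmallImage)
open Summit.BirchSwinnertonDyer.BirchSwinnertonDyer.Theorems
open Literature.NumberTheory.EllipticCurves

/-! ## § Decomposition D5: by prime, `5 ≤ p` / `p < 5` -/

/-- Child 1 (`p ≥ 5`): for `E/ℚ` (globally minimal `W`), every good ordinary prime `p ≥ 5` and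
the newform `f` of `E`, `ord_{T=0} L_p(f, α_p, T) = ord_{s=1} L(E, s)`. This is crux #2 with the
binder `5 ≤ p →` — verbatim the repair statement pre-declared by the route (KILL CRITERIA (c)).
ITEMS-ONLY today (`compFiveLe_of_fiveRouteItems`). -/
def CompFiveLe : Prop :=
  ∀ (W : WeierstrassCurve ℚ) [W.IsElliptic] [W.IsGloballyMinimal] (p : ℕ) [Fact p.Prime],
    5 ≤ p → IsOrdinaryAt W p →
    ∀ {N : ℕ} [NeZero N] (f : CuspForm (CongruenceSubgroup.Gamma0 N) 2),
      ModularForms.IsNewformOf W f →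
        (padicLFunction f (unitRoot W p : ℚ_[p])).order = W.analyticRank

/-- Child 2 (`p < 5`, i.e. `p ∈ {2, 3}`): the small-prime residue of crux #2. At `p = 3` it is
items-only (items 15426 `3 ≤ p`, 0509 `p ≠ 2`); at `p = 2` it carries the two stuck stubs of line
`Sketch` v13 (K2 = Kato Thm 18.4 twin, literature debt; NE2⁺ = no excess zeros at 2, beyond print). -/
def CompSmall : Prop :=
  ∀ (W : WeierstrassCurve ℚ) [W.IsElliptic] [W.IsGloballyMinimal] (p : ℕ) [Fact p.Prime],
    p < 5 → IsOrdinaryAt W p →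
    ∀ {N : ℕ} [NeZero N] (f : CuspForm (CongruenceSubgroup.Gamma0 N) 2),
      ModularForms.IsNewformOf W f →
        (padicLFunction f (unitRoot W p : ℚ_[p])).order = W.analyticRank

/-- GLUE (trivial seam): the two children give the crux BY NAME. [folklore] -/
theorem pAdicOrderComparisonR2_of_byPrime (h5 : CompFiveLe) (hS : CompSmall) :
    PAdicOrderComparisonR2 := by
  intro W _ _ p _ hord N _ f hf
  rcases Nat.lt_or_ge p 5 with hlt | hge
  · exact hS W p hlt hord f hf
  · exact h5 W p hge hord f hf

/-- EXACTNESS: each child is a literal weakening of the crux. [folklore] -/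
theorem byPrime_of_pAdicOrderComparisonR2 (h : PAdicOrderComparisonR2) : CompFiveLe ∧ CompSmall :=
  ⟨fun W _ _ p _ _ hord _ _ f hf => h W p hord f hf, fun W _ _ p _ _ hord _ _ f hf => h W p hord f hf⟩

/-- The split is exact: crux ⇔ both children. [folklore] -/
theorem pAdicOrderComparisonR2_iff_byPrime : PAdicOrderComparisonR2 ↔ CompFiveLe ∧ CompSmall :=
  ⟨byPrime_of_pAdicOrderComparisonR2, fun h => pAdicOrderComparisonR2_of_byPrime h.1 h.2⟩

/-- Child 1 is ITEMS-ONLY: `CompFiveLe` from five route items — SelmerRank `LB` (stmt-0131),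
`UB` (stmt-0130), `SmallImage` (stmt-14418), crux #4 `PAdicOrderSemisimpleR3` (stmt-0509) and crux #7
`PAdicOrderMainConjectureR7` (stmt-15426) — by the landed
`order_eq_analyticRank_five_le_of_fiveRouteItems` (p138680; chain `ord_T L_p = ord_T g = rank X/TX =
corank Sel = r_an`, Mazur control discharged in tree). No stub, no Literature hypothesis: a line on
`CompFiveLe` would have nothing to register. [folklore] -/
theorem compFiveLe_of_fiveRouteItems (hLB : SelmerRankLB) (hUB : SelmerRankUB)
    (hSI : SelmerRankSmallImage) (hSS : PAdicOrderSemisimpleR3) (hMC : PAdicOrderMainConjectureR7) :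
    CompFiveLe :=
  fun W _ _ p _ hp5 hord _ _ f hf =>
    order_eq_analyticRank_five_le_of_fiveRouteItems hLB hUB hSI hSS hMC W p hp5 hord f hf

/-- Consequently, modulo the five route items the crux is EQUIVALENT to its small-prime residue
`CompSmall` — the precise sense in which the stall of line `Sketch` (stubs K2 / NE2⁺ at `p = 2`) is
an artifact of the `∀ p` typing and not a property of the route's thesis (which needs one `p ≥ 5`).
[folklore] -/
theorem pAdicOrderComparisonR2_iff_compSmall_of_fiveRouteItems (hLB : SelmerRankLB)
    (hUB : SelmerRankUB) (hSI : SelmerRankSmallImage) (hSS : PAdicOrderSemisimpleR3)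
    (hMC : PAdicOrderMainConjectureR7) : PAdicOrderComparisonR2 ↔ CompSmall :=
  ⟨fun h => (byPrime_of_pAdicOrderComparisonR2 h).2,
    fun hS => pAdicOrderComparisonR2_of_byPrime (compFiveLe_of_fiveRouteItems hLB hUB hSI hSS hMC) hS⟩

end Summit.BirchSwinnertonDyer.BirchSwinnertonDyer.Cruxes.PAdicOrderComparisonR2.Strategist2
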